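import Literature.NumberTheory.Automorphic.LocalLanglandsDatum
import Literature.NumberTheory.Automorphic.LocalLanglandsGLProofs
import Literature.NumberTheory.Automorphic.LocalConstantsProofs
import Literature.NumberTheory.GaloisRepresentations.LocalGaloisGroupProofs
import Literature.NumberTheory.GaloisRepresentations.LocalGaloisGroupFrobeniusProofs
import HarnessLib

/-!
# `LocalLanglandsDatum.nonempty`: reduction to its two printed constituents

Topic `Literature/NumberTheory/Automorphic`, sibling of `LocalLanglandsDatum` (the structure
`Literature.NumberTheory.Automorphic.LocalLanglandsDatum F` bundling a local Langlands
correspondence for the general linear groups over a non-archimedean local field `F`, and the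
named fact `LocalLanglandsDatum.nonempty`: such a datum exists for every `F`).

The docstring of `LocalLanglandsDatum.nonempty` records its provenance: "Harris–Taylor 2001,
Thm. A; Henniart 2000, Thm. 1.2; with local class field theory, Deligne's local constants and
the threaded `LocalGaloisGroup` facts", i.e. the named facts `localLanglands_gl` (**lang.S09**),
`nonempty_localEpsilonSystem` (Deligne 1973, Thm. 4.1) and the six threaded facts
`IsFrobPow.mul`, `IsFrobPow.unique`, `absInertia_normal`, `exists_isFrobPow`,
`WeilGroup.exists_subgroup_le_inertia_isOpen_of_continuous`, `isOpen_ker_quasiChar`.  The six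
threaded facts are discharged in the tree (`IsFrobPow.mul_holds`, `IsFrobPow.unique_holds`,
`absInertia_normal_holds`, `exists_isFrobPow_holds`,
`WeilGroup.exists_subgroup_le_inertia_isOpen_of_continuous_holds`, `isOpen_ker_quasiChar_holds`);
this file proves the assembly, so that the fact is formally reduced to the two deep ones:

* `LocalLanglandsDatum.nonempty_of_isLocalLanglandsGL` — any family `rec` with
  `IsLocalLanglandsGL F … d 𝓔 rec` and `𝓔.artin F = d` gives a datum;
* `LocalLanglandsDatum.nonempty_of_localLanglands_gl` — the same from the existence statement
  `localLanglands_gl F … d 𝓔 hd` at one `F`;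
* `LocalLanglandsDatum.nonempty_of` — **`LocalLanglandsDatum.nonempty` follows from
  `localLanglands_gl` (at every `F`, for the Artin data `𝓔.artin F` of a system of local
  constants `𝓔`, with the discharged threaded facts) and `nonempty_localEpsilonSystem` (at every
  `F`)**; no local Artin datum has to be supplied separately (`nonempty_localArtinData`), the
  system of local constants carries its own;
* `LocalLanglandsDatum.nonempty_localEpsilonSystem_of_nonempty` — conversely a datum carries a
  system of local constants, so the fact is at least Deligne's existence theorem.

Written in support of the discharge path of
`Varma2024.theorem12_trace_eq_and_precI` (`VarmaLocalGlobalPrecI`), whose first obligation is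
`∃ 𝓛 : ∀ v, LocalLanglandsDatum (K_v)`.  Theorems only: no definitions, no new named facts.
Kept in a separate leaf file so that `LocalLanglandsDatum` (imported by summit statements) does
not acquire the five `…Proofs` imports.

## References

* M. Harris, R. Taylor, *The geometry and cohomology of some simple Shimura varieties*, Ann. of
  Math. Stud. 151 (2001), Thm. A. [HarrisTaylorAMS2001]
* G. Henniart, *Une preuve simple des conjectures de Langlands pour GL(n) sur un corps
  p-adique*, Invent. Math. 139 (2000), Thm. 1.2. [HenniartInventiones2000]
* P. Deligne, *Les constantes des équations fonctionnelles des fonctions L*, Antwerp II, LNM 349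
  (1973), Thm. 4.1.
-/

noncomputable section

open scoped MatrixGroups

namespace Literature.NumberTheory.Automorphic

namespace LocalLanglandsDatum

open Literature.NumberTheory.GaloisRepresentations

variable {F : Type} [Field F] [ValuativeRel F] [TopologicalSpace F] [IsNonarchimedeanLocalField F]

/-- A local Langlands correspondence `rec` for the general linear groups over `F`
(`IsLocalLanglandsGL F … d 𝓔 rec`, for any proofs of the threaded facts), normalised by the
Artin data `d = 𝓔.artin F` of its system of local constants, gives a `LocalLanglandsDatum F`
(the remaining field `hqc` is the discharged `isOpen_ker_quasiChar_holds`).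
[cite: HarrisTaylorAMS2001, Thm. A] -/
theorem nonempty_of_isLocalLanglandsGL {hmul : IsFrobPow.mul (F := F)}
    {huniq : IsFrobPow.unique (F := F)} {hn : absInertia_normal F}
    {hex : exists_isFrobPow (F := F)}
    {hns : WeilGroup.exists_subgroup_le_inertia_isOpen_of_continuous (F := F)}
    {d : LocalArtinData F} {𝓔 : LocalEpsilonSystem F} (hd : 𝓔.artin F = d)
    {rec : ∀ n : ℕ, IrrClass (GL (Fin n) F) → Quotient (frobSemisimpleWDSetoid F n)}
    (h : IsLocalLanglandsGL F hmul huniq hn hex hns d 𝓔 rec) :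
    Nonempty (LocalLanglandsDatum F) :=
  ⟨{ hmul := hmul, huniq := huniq, hn := hn, hex := hex, hns := hns,
     hqc := isOpen_ker_quasiChar_holds, artin := d, eps := 𝓔, eps_artin := hd, recGL := rec,
     isLocalLanglands := h }⟩

/-- The existence statement **lang.S09** at `F` (`localLanglands_gl F … d 𝓔 hd`: there is a
local Langlands correspondence normalised by `d` and `𝓔`, unique on supercuspidals) gives a
`LocalLanglandsDatum F`. [cite: HarrisTaylorAMS2001, Thm. A] -/
theorem nonempty_of_localLanglands_gl {hmul : IsFrobPow.mul (F := F)}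
    {huniq : IsFrobPow.unique (F := F)} {hn : absInertia_normal F}
    {hex : exists_isFrobPow (F := F)}
    {hns : WeilGroup.exists_subgroup_le_inertia_isOpen_of_continuous (F := F)}
    {d : LocalArtinData F} {𝓔 : LocalEpsilonSystem F} (hd : 𝓔.artin F = d)
    (h : localLanglands_gl F hmul huniq hn hex hns d 𝓔 hd) :
    Nonempty (LocalLanglandsDatum F) := by
  obtain ⟨rec, hrec, -⟩ := h
  exact nonempty_of_isLocalLanglandsGL hd hrec

/-- **`LocalLanglandsDatum.nonempty` from its printed constituents.**  If, over every
non-archimedean local field `F` (in `Type`) and for every system of local constants `𝓔` over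
`F`, the local Langlands correspondence for the general linear groups exists with the
normalisation `(𝓔.artin F, 𝓔)` (the named fact `localLanglands_gl`, Harris–Taylor 2001 Thm. A /
Henniart 2000 Thm. 1.2, taken at the discharged proofs of the threaded `LocalGaloisGroup` facts),
and if over every such `F` a system of local constants exists (the named fact
`nonempty_localEpsilonSystem`, Deligne 1973 Thm. 4.1), then `LocalLanglandsDatum F` is inhabited
for every `F`. [cite: HarrisTaylorAMS2001, Thm. A] -/
theorem nonempty_of
    (hgl : ∀ (F : Type) [Field F] [ValuativeRel F] [TopologicalSpace F]
      [IsNonarchimedeanLocalField F] (𝓔 : LocalEpsilonSystem F),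
      localLanglands_gl F IsFrobPow.mul_holds IsFrobPow.unique_holds (absInertia_normal_holds F)
        (exists_isFrobPow_holds F) WeilGroup.exists_subgroup_le_inertia_isOpen_of_continuous_holds
        (𝓔.artin F) 𝓔 rfl)
    (heps : ∀ (F : Type) [Field F] [ValuativeRel F] [TopologicalSpace F]
      [IsNonarchimedeanLocalField F], nonempty_localEpsilonSystem F) :
    LocalLanglandsDatum.nonempty := by
  intro F _ _ _ _
  obtain ⟨𝓔⟩ := heps F
  exact nonempty_of_localLanglands_gl rfl (hgl F 𝓔)

/-- Conversely, a local Langlands datum carries a system of local constants: the fact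
`LocalLanglandsDatum.nonempty` implies `nonempty_localEpsilonSystem F` for every `F`
(so it is at least Deligne's existence theorem for the local constants). [folklore] -/
theorem nonempty_localEpsilonSystem_of_nonempty (h : LocalLanglandsDatum.nonempty)
    (F : Type) [Field F] [ValuativeRel F] [TopologicalSpace F] [IsNonarchimedeanLocalField F] :
    nonempty_localEpsilonSystem F := by
  obtain ⟨L⟩ := h F
  exact ⟨L.eps⟩

/-- A datum also yields the existence half of **lang.S09** at its own normalisation together with
its system of local constants: `∃ 𝓔 d (hd : 𝓔.artin F = d) rec, IsLocalLanglandsGL F … d 𝓔 rec`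
(cf. `exists_isLocalLanglandsGL`). [folklore] -/
theorem exists_localEpsilonSystem_isLocalLanglandsGL (L : LocalLanglandsDatum F) :
    ∃ (𝓔 : LocalEpsilonSystem F) (d : LocalArtinData F), 𝓔.artin F = d ∧
      ∃ rec : ∀ n : ℕ, IrrClass (GL (Fin n) F) → Quotient (frobSemisimpleWDSetoid F n),
        IsLocalLanglandsGL F L.hmul L.huniq L.hn L.hex L.hns d 𝓔 rec :=
  ⟨L.eps, L.artin, L.eps_artin, L.recGL, L.isLocalLanglands⟩

end LocalLanglandsDatum

end Literature.NumberTheory.Automorphic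

end
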